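import Summits.QuantumFields.YangMills.Theses.WeakCouplingRates
import Summits.QuantumFields.YangMills.Theorems.WeakCouplingRatesBulkDominatesColdBoxWDefs
import Summits.QuantumFields.YangMills.Theorems.WeakCouplingRatesBulkDominatesColdBoxWStubLargeFieldRarity
import Summits.QuantumFields.YangMills.Theorems.WeakCouplingRatesBulkDominatesColdBoxWStubDlrAssembly
import Summits.QuantumFields.YangMills.Theorems.WeakCouplingRatesLargeFieldTail
import Summits.QuantumFields.YangMills.Theorems.WeakCouplingRatesBulkDominatesColdBoxWMeanSmoothOfExpansion
import Summits.QuantumFields.YangMills.Theorems.WeakCouplingRatesBulkDominatesColdBoxWCovStableOfExpansion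
import Summits.QuantumFields.YangMills.Theorems.WeakCouplingRatesBulkDominatesColdBoxWDirKernelDiagFlat
import Summits.QuantumFields.YangMills.Theorems.WeakCouplingRatesBulkDominatesColdBoxWStubDirKernelTwoPoint
import Summits.QuantumFields.YangMills.Theorems.WeakCouplingRatesBulkDominatesColdBoxWFlatCovOfDomAbs
import Summits.QuantumFields.YangMills.Theorems.WeakCouplingRatesColdBoxTwoPointFloorWStubBoxGaussianDomination

/-!
# Line `dlr-chessboard` v6 — v5 with the two Dirichlet potential-theory sub-stubs CLOSED by tree theorems

Lead: fleet seat `prover-ym-wcr-19609-p1-g2-0` (2026-08-26).  v6 = v5 (sha16 5c2c32c11bf29ef1, item evidence #25) with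
`stub_dirKernelTwoPoint` CLOSED by name (`Theorems.WeakCouplingRates.stub_dirKernelTwoPoint`, p470265, from `dirKernelTwoPoint` of
`Theorems/WeakCouplingRatesBulkDominatesColdBoxWDirKernelTwoPoint.lean`, seat ym-spine-20043-p1 g3) and `stub_dirKernelDiagFlat` CLOSED inside the
composition by the tree theorem `dirKernelDiagFlat` (`Theorems/WeakCouplingRatesBulkDominatesColdBoxWDirKernelDiagFlat.lean`, same seat; a by-name
restatement is refused by the dedup gate, p470257).  Open after v6 (4): `stub_kernelMeanExpansion`, `stub_kernelCovExpansion`,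
`stub_flatCovExpansion`, `stub_boxPolyFloor`; the composition `BulkDominatesColdBoxW_of` takes exactly these four.  **v7 (2026-08-27T01:00Z):
`stub_flatCovExpansion` CLOSED (⇐ `boxDirichletDominationAbs`, 19456-g2, via `flatCovExpansion_of_domAbs`); OPEN (3): `stub_kernelMeanExpansion`,
`stub_kernelCovExpansion`, `stub_boxPolyFloor`; the composition takes exactly these three.**  The v5 docstring follows.

# Line `dlr-chessboard` v5 — LEAD RESHAPE (census v3) for crux `BulkDominatesColdBoxW` (stmt-QuantumFields-19609): L1a / L1b SPLIT into
# the one-scale expansion interfaces and the Dirichlet potential theory they consume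

Lead: fleet seat `prover-ym-wcr-19609-p1-g2-0` (unit `ym-wcr-19609-p1`, successor of g0, 2026-08-26).  v5 = v4 + the census-v3 split
(item evidence #12, `FINDING-19609-census-v3.md`): uniformly over crude-good data the box kernel linearises around the FLAT configuration and the
datum only shifts the mean of the Dirichlet Gaussian D1' (`LatticeMaxwell.mean`; background circulation harmonic, interior sup/gradient bounds from
energy — tree files `Theorems/WeakCouplingRatesBulkDominatesColdBoxW{DatumBackground,DatumBackgroundInterior,ForestGaugeDatum,ForestPoincareDatum,
DatumShiftIntegral}.lean`, p464225/p464967/p465402/p465457/p465976).  Accordingly the two open analytic stubs of v4 are now DERIVED inside the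
composition from FIVE registered sub-stubs over the interface predicates of `Theorems/WeakCouplingRatesBulkDominatesColdBoxWDefs.lean`
(appended p467021/p468619), by the kernel-checked reductions
`goodBoundaryMeanSmooth_of_kernelMeanExpansion` (`…MeanSmoothOfExpansion.lean`, p467846/p468280) and
`goodBoundaryCovStable_of_kernelCovExpansion` (`…CovStableOfExpansion.lean`, p469747/p470022):
* L1b `stub_goodBoundaryMeanSmooth` ⇐ `stub_kernelMeanExpansion` (N2, mean form: `β·E_ω[c_q] = (3/2)V_D(q) + β·Σ_c F̄_c(q)² ± β^{−θ}` within `H/8`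
  of the centre, energy `≤ 16(2H+3)⁴β^{2δ−1}`; size L — the datum-generic S3c assembly) ∧ `stub_dirKernelDiagFlat` (N1′: `|ΔV_D| ≤ K/H` near the
  centre; size S–M — Dirichlet twin of `exists_boxProjKernel_sub_curl_bound`);
* L1a `stub_goodBoundaryCovStable` ⇐ `stub_kernelCovExpansion` (N2, covariance form, error `β^{−θ/2}`; size L) ∧ `stub_flatCovExpansion` (the
  sibling crux's S3c in Dirichlet dress, `|β²·boxPlaqCov − (3/2)C_D²| ≤ β^{−θ/2}`; size L, = 19608's line) ∧ `stub_dirKernelTwoPoint`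
  (`κ′/T⁴ ≤ C_D(p, p+Te₀) ≤ 1` for all `0 < A < θ`; size M — Dirichlet-vs-ℤ⁴ comparison + FLOOR + `integral_dirCirc_sq_le_one`).
Open after v5 (6 ≤ stubs_max): `stub_kernelMeanExpansion`, `stub_dirKernelDiagFlat`, `stub_kernelCovExpansion`, `stub_flatCovExpansion`,
`stub_dirKernelTwoPoint`, `stub_boxPolyFloor` (= BOX_W 19608 + FLOOR, `boxPolyFloor_of_box_floor`).  The composition `BulkDominatesColdBoxW_of`
takes exactly these six and concludes the crux BY NAME; `stub_boxPolyFloor`'s signature is byte-identical to v2–v4.  The v4 docstring follows.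

# Line `dlr-chessboard` v4 — LEAD RESHAPE (tree-first) of the owner's v2 for crux `BulkDominatesColdBoxW` (stmt-QuantumFields-19609)

Lead: fleet seat `prover-ym-wcr-19609-p1-g0-0` (unit `ym-wcr-19609-p1`, 2026-08-26).  v4 = v3 + **stub L3 `stub_dlrAssembly` CLOSED** by the
tree theorem `Theorems.WeakCouplingRates.stub_dlrAssembly` (`Theorems/WeakCouplingRatesBulkDominatesColdBoxWStubDlrAssembly.lean` +
`…DlrPlumbing.lean`, p447917: DLR equations of the torus state for `boxEdges 4 (2H+1)` on torus sides `L+1 > 2(2H+T+2)`, translation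
invariance, the abstract law of total covariance with the bad event `{some corona plaquette > β^{2δ−1}}` of mass `≤ 6(2H+3)⁴e^{−β^δ}` by L2,
and the window arithmetic; `η = η₁/2`).  Open after v4: `stub_goodBoundaryCovStable` (L1a, XL), `stub_goodBoundaryMeanSmooth` (L1b, L),
`stub_boxPolyFloor` (= items 19608 + 19457).  v3 = the owner's registered v2
(`pub/ym-beyond/p3-g13-files/LINE-dlr-chessboard-W.v2.lean`, sha16 021c654069d76526, planner ym-beyond-p3 g13) with exactly TWO changes and
NO change to any registered stub signature (byte-identical `Stmt.stub_*` abbrevs and stub headers):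
1. the line's seven posited objects (`PlaquetteLargeFieldRarity`, `boxKernel`, `CrudeGood`, `GoodBoundaryCovStable`, `GoodBoundaryMeanSmooth`,
   `BoxPolyFloor`, `DlrAssembly`) are no longer declared here: they are IMPORTED from the tree module
   `Theorems/WeakCouplingRatesBulkDominatesColdBoxWDefs.lean` (p445725, bodies verbatim = v2's) through the `open … Theorems.WeakCouplingRates` below,
   so that every stub lands BY NAME against tree objects;
2. **stub L2 `stub_largeFieldRarity` is CLOSED** — ALL torus sides, every `δ > 0` — by the tree theorem
   `Theorems.WeakCouplingRates.stub_largeFieldRarity` (`Theorems/WeakCouplingRatesBulkDominatesColdBoxWStubLargeFieldRarity.lean`; content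
   `Theorems/WeakCouplingRatesLargeFieldTailAllSides.lean`, p445390: odd sides via the tree's iterated site-reflection doubling on the odd torus
   `SoloBlind.wilsonExpectation_exp_plaquetteCost_le` + crude partition-function bounds; even sides `su2_measureReal_plaqCost_ge_le`).
Open stubs after v3: `stub_goodBoundaryCovStable` (L1a, XL, load-bearing), `stub_goodBoundaryMeanSmooth` (L1b, L), `stub_boxPolyFloor`
(= BOX_W 19608 + FLOOR 19457 + arithmetic), `stub_dlrAssembly` (L3, M — the lead's next target).  The v2 module docstring follows verbatim.

# Line `dlr-chessboard` v2 — WINDOW-PARAMETRIC re-cut for crux `BulkDominatesColdBoxW` (stmt-QuantumFields-19609; replaces 19455 `BulkDominatesColdBox`)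

Owner: planner `ym-beyond-p3` g13 (2026-08-26), route `WeakCouplingRates` rev 2 (commit ec0f9e61ceaa).  v2 = the registered v1
(`pub/ym-beyond/p3-g12-files/LINE-dlr-chessboard.lean`, sha16 920e42947bc1df1d, registered against the now-RETIRED item 19455 at the fixed
parameter point (A, δ, θ, K) = (1/200, 1/50, 1/9, 41/20)) with the SAME objects and predicates (`PlaquetteLargeFieldRarity`, `CrudeGood`,
`GoodBoundaryCovStable`, `GoodBoundaryMeanSmooth`, `BoxPolyFloor`, `DlrAssembly` — verbatim) and the stubs made PARAMETRIC IN THE BOX EXPONENT θ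
along the one-parameter family `(A, δ, θ, K) = (θ/20, θ/5, θ, 2 + θ/2)` (window check: K + 4δ + 2A = 2 + 1.4θ < 2 + 2θ; 5A + 2δ = 0.65θ < θ;
at θ = 1/50 this is exactly the point (1/1000, 1/250, 1/50, 2.01) named in the crux docstring), each one-scale stub under a ceiling θ₁ of the
prover's choosing — so that the composition delivers exponents below EVERY θ₀, as the rev-2 crux `BulkDominatesColdBoxW := ∀ θ₀ > 0, ∃ 0 < A < θ ≤ θ₀,
BulkDominatesBox A θ` demands (the deciding theorem instantiates it at BOX_W's ceiling).

## Stubs, sizes, and the LINE №57 «consumes:» audit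
* L2 `stub_largeFieldRarity` : ∀ δ > 0, `PlaquetteLargeFieldRarity δ` (ALL large torus sides; size M) — consumes `0 < δ` (threshold β^{2δ−1} above the
  Gaussian scale), `β₀ ≤ β`, `∀ᶠ L` (all large sides: odd sides need the mixed RP / odd-period chessboard folding); EVEN sides = the tree theorem
  `Theorems.WeakCouplingRates.stub_largeFieldRarityEven` (p411836), cited by name below (CLOSED half).
* L1a `stub_goodBoundaryCovStable` : ∃ θ₁ > 0, ∀ 0 < θ ≤ θ₁, ∃ η₁ > 0, `GoodBoundaryCovStable (θ/20) θ (θ/5) η₁` (LOAD-BEARING, size XL) — consumes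
  `0 < θ` (box grows), `θ ≤ θ₁` (one-scale small-field expansion around the small background extending a crude-good datum: union/volume counts over
  β^{4θ} plaquettes), `CrudeGood β δ H ω` (THE hypothesis: boundary plaquettes ≤ β^{2δ−1}), `β₀ ≤ β` — no idle binder.
* L1b `stub_goodBoundaryMeanSmooth` : ∃ θ₁ > 0, ∀ 0 < θ ≤ θ₁, `GoodBoundaryMeanSmooth (θ/20) θ (θ/5)` (size L) — consumes `CrudeGood` (small Dirichlet
  data ⇒ small smooth background, elliptic regularity), `0 < θ`, `θ ≤ θ₁`, `β₀ ≤ β` — no idle binder.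
* `stub_boxPolyFloor` : ∃ θ₁ > 0, ∀ 0 < θ ≤ θ₁, `BoxPolyFloor (θ/20) θ (2 + θ/2)` (size S–M) — NOT independent content: it is the route's crux BOX_W
  (`ColdBoxTwoPointFloorW`, item 19608) + support FLOOR (`CurvatureCorrPowerFloor`, item 19457) + rpow arithmetic (c·β^{−2}·C(⌈β^{θ/20}⌉)² ≥
  (cκ²/256)·β^{−2−0.4θ} ≥ β^{−(2+θ/2)} eventually); lands as a one-file consequence the day those two items close (or directly).  consumes `θ ≤ θ₁`
  (:= BOX_W's ceiling), `0 < θ`.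
* L3 `stub_dlrAssembly` : `DlrAssembly` (fully parametric already in v1; size M, probability + DLR plumbing) — consumes every hypothesis (law of total
  covariance, good/bad split with |c| ≤ 4, union bound over ≤ 6(2H+3)⁴ corona plaquettes using L2 + translation invariance, the ¼Var term via L1b,
  the window inequality `K + 4δ + 2A < 2 + 2θ` makes it o(β^{−K}) against `BoxPolyFloor`).
* NOT carried from v1: `stub_bulkU1` (BC5 plan-only U(1) analogue) — superseded as the route's T3 witness by the LANDED even-side rarity theorem
  `plaquetteLargeFieldRarity_evenSide` (tribunal_fit.witness); it stays on the retired item's record.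
* `BulkDominatesColdBoxW_of` : the five stubs BY NAME ⇒ the crux BY NAME (θ := min θ₀ θ₁ᵃ θ₁ᵇ θ₁ᵏ; L3 at (θ/20, θ/5, θ, 2 + θ/2)).  Kernel-checked.
-/

open MeasureTheory Filter Topology
open Literature.MathematicalPhysics Literature.MathematicalPhysics.QuantumFieldTheory
open Literature.MathematicalPhysics.QuantumLattice
open Summit.QuantumFields.YangMills.Theorems Summit.QuantumFields.YangMills.Theorems.WeakCouplingRates

namespace Summit.QuantumFields.YangMills.Cruxes.BulkDominatesColdBoxW.DlrChessboard

/-! (v3) The posited objects `PlaquetteLargeFieldRarity`, `boxKernel`, `CrudeGood`, `GoodBoundaryCovStable`, `GoodBoundaryMeanSmooth`,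
`BoxPolyFloor`, `DlrAssembly` are the tree's (`Theorems.WeakCouplingRates.*`, module `WeakCouplingRatesBulkDominatesColdBoxWDefs`), opened above. -/

/-! ## Registered skeleton (BC3 shape): named stubs, parametric in the box exponent θ along (A, δ, θ, K) = (θ/20, θ/5, θ, 2 + θ/2),
and the kernel-checked composition concluding the rev-2 crux `BulkDominatesColdBoxW` BY NAME. -/

/-- L2 — crude single-plaquette large-field rarity, uniformly in the volume, at EVERY exponent δ > 0 (ALL large sides; even sides are the tree
theorem `Theorems.WeakCouplingRates.stub_largeFieldRarityEven`, odd sides need the mixed RP + odd-period chessboard folding). -/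
abbrev Stmt.stub_largeFieldRarity : Prop := ∀ δ : ℝ, 0 < δ → PlaquetteLargeFieldRarity δ

/-- L1a — deep covariances are stable under crude-good boundary data, along the family, under a ceiling θ₁ (one-scale small-field expansion). -/
abbrev Stmt.stub_goodBoundaryCovStable : Prop :=
  ∃ θ₁ : ℝ, 0 < θ₁ ∧ ∀ θ : ℝ, 0 < θ → θ ≤ θ₁ → ∃ η₁ : ℝ, 0 < η₁ ∧ GoodBoundaryCovStable (θ / 20) θ (θ / 5) η₁

/-- L1b — deep conditional means are position-smooth for crude-good boundary data, along the family, under a ceiling θ₁. -/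
abbrev Stmt.stub_goodBoundaryMeanSmooth : Prop :=
  ∃ θ₁ : ℝ, 0 < θ₁ ∧ ∀ θ : ℝ, 0 < θ → θ ≤ θ₁ → GoodBoundaryMeanSmooth (θ / 20) θ (θ / 5)

/-- Polynomial cold-box floor with exponent `K = 2 + θ/2` along the family, under a ceiling (= crux BOX_W + support FLOOR + arithmetic:
`2 + 8A = 2 + 0.4θ < 2 + θ/2`). -/
abbrev Stmt.stub_boxPolyFloor : Prop :=
  ∃ θ₁ : ℝ, 0 < θ₁ ∧ ∀ θ : ℝ, 0 < θ → θ ≤ θ₁ → BoxPolyFloor (θ / 20) θ (2 + θ / 2)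

/-- L3 — the DLR assembly (law of total covariance over `ymSpecification`, good/bad split, translation invariance, DLR consistency). -/
abbrev Stmt.stub_dlrAssembly : Prop := DlrAssembly

/-- The EVEN-SIDE half of L2, ALREADY A TREE THEOREM (`Theorems.WeakCouplingRates.stub_largeFieldRarityEven`, p411836, commit b5e5743fa1e6) — kept
registered so the landed proof stays credited to the crux; `stub_largeFieldRarity` (all large sides, all δ > 0) is what the composition consumes. -/
abbrev Stmt.stub_largeFieldRarityEven : Prop :=
  ∀ δ : ℝ, 0 < δ → ∃ β₀ : ℝ, ∀ β : ℝ, β₀ ≤ β → ∀ L : ℕ, Even (L + 1) →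
    Literature.MathematicalPhysics.QuantumFieldTheory.wilsonExpectation (L := L + 1)
        (Literature.MathematicalPhysics.QuantumLattice.fundamentalRep (Fin 2)) β
        (Literature.MathematicalPhysics.QuantumLattice.toTorusObservable (L + 1) fun U :
            Literature.MathematicalPhysics.QuantumLattice.LGConfig 4 (Matrix.specialUnitaryGroup (Fin 2) ℂ) =>
          if β ^ (2 * δ - 1) ≤ Summit.QuantumFields.YangMills.Theorems.WeakCouplingRates.plaqCost0
              (Literature.MathematicalPhysics.QuantumLattice.fundamentalRep (Fin 2)) 1 2 U then (1 : ℝ) else 0) ≤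
      Real.exp (-(β ^ δ))

/-- Proved in the tree: this is `Theorems.WeakCouplingRates.stub_largeFieldRarityEven` by name. -/
theorem stub_largeFieldRarityEven : Stmt.stub_largeFieldRarityEven :=
  Summit.QuantumFields.YangMills.Theorems.WeakCouplingRates.stub_largeFieldRarityEven

/-- (v3) CLOSED in the tree: `Theorems.WeakCouplingRates.stub_largeFieldRarity` (all torus sides, every δ > 0). -/
theorem stub_largeFieldRarity : ∀ δ : ℝ, 0 < δ → PlaquetteLargeFieldRarity δ :=
  Summit.QuantumFields.YangMills.Theorems.WeakCouplingRates.stub_largeFieldRarity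

/-! ### (v5) The five registered SUB-STUBS of L1a / L1b (census v3) -/

/-- N2 (mean form) — the one-scale expansion of deep kernel MEANS along `δ = θ/5`, uniformly over crude-good data, below a ceiling. -/
abbrev Stmt.stub_kernelMeanExpansion : Prop :=
  ∃ θ₂ : ℝ, 0 < θ₂ ∧ ∀ θ : ℝ, 0 < θ → θ ≤ θ₂ → KernelMeanExpansion θ (θ / 5)

/-- N1′ — the D1′ plaquette variance is flat near the centre of the cold box. -/
abbrev Stmt.stub_dirKernelDiagFlat : Prop := DirKernelDiagFlat

/-- N2 (covariance form) — the one-scale expansion of the deep kernel COVARIANCE along `(A, δ) = (θ/20, θ/5)`, below a ceiling. -/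
abbrev Stmt.stub_kernelCovExpansion : Prop :=
  ∃ θ₂ : ℝ, 0 < θ₂ ∧ ∀ θ : ℝ, 0 < θ → θ ≤ θ₂ → KernelCovExpansion (θ / 20) θ (θ / 5)

/-- N2 (flat covariance form) — the sibling crux's S3c in Dirichlet dress along `A = θ/20`, below a ceiling. -/
abbrev Stmt.stub_flatCovExpansion : Prop :=
  ∃ θ₂ : ℝ, 0 < θ₂ ∧ ∀ θ : ℝ, 0 < θ → θ ≤ θ₂ → FlatCovExpansion (θ / 20) θ

/-- N1 (two-point form) — Coulomb size of the Dirichlet curvature kernel at depth `⌈β^A⌉ ≪ ⌈β^θ⌉`, for all `0 < A < θ`. -/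
abbrev Stmt.stub_dirKernelTwoPoint : Prop := ∀ A θ : ℝ, 0 < A → A < θ → DirKernelTwoPoint A θ

theorem stub_kernelMeanExpansion : ∃ θ₂ : ℝ, 0 < θ₂ ∧ ∀ θ : ℝ, 0 < θ → θ ≤ θ₂ → KernelMeanExpansion θ (θ / 5) := by
  sorry

/-- (v6) CLOSED in the tree: `Theorems.WeakCouplingRates.dirKernelDiagFlat` (seat ym-spine-20043-p1 g3). -/
theorem stub_dirKernelDiagFlat : DirKernelDiagFlat :=
  Summit.QuantumFields.YangMills.Theorems.WeakCouplingRates.dirKernelDiagFlat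

theorem stub_kernelCovExpansion : ∃ θ₂ : ℝ, 0 < θ₂ ∧ ∀ θ : ℝ, 0 < θ → θ ≤ θ₂ → KernelCovExpansion (θ / 20) θ (θ / 5) := by
  sorry

/-- (v7) CLOSED in the tree: the sibling crux's absolute Dirichlet domination `boxDirichletDominationAbs` (seat ym-wcr-19456-p1, 00:55Z) through the
bridge `flatCovExpansion_of_domAbs` (p475199); BY NAME as `Theorems.WeakCouplingRates.stub_flatCovExpansion` (p480257). -/
theorem stub_flatCovExpansion : ∃ θ₂ : ℝ, 0 < θ₂ ∧ ∀ θ : ℝ, 0 < θ → θ ≤ θ₂ → FlatCovExpansion (θ / 20) θ :=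
  flatCovExpansion_of_domAbs Summit.QuantumFields.YangMills.Theorems.WeakCouplingRates.boxDirichletDominationAbs

/-- (v6) CLOSED in the tree BY NAME: `Theorems.WeakCouplingRates.stub_dirKernelTwoPoint` (p470265). -/
theorem stub_dirKernelTwoPoint : ∀ A θ : ℝ, 0 < A → A < θ → DirKernelTwoPoint A θ :=
  Summit.QuantumFields.YangMills.Theorems.WeakCouplingRates.stub_dirKernelTwoPoint

/-- (v5) L1a is DERIVED: `Theorems.WeakCouplingRates.goodBoundaryCovStable_of_kernelCovExpansion` (kernel-checked reduction, p469747/p470022). -/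
theorem stub_goodBoundaryCovStable :
    ∃ θ₁ : ℝ, 0 < θ₁ ∧ ∀ θ : ℝ, 0 < θ → θ ≤ θ₁ → ∃ η₁ : ℝ, 0 < η₁ ∧ GoodBoundaryCovStable (θ / 20) θ (θ / 5) η₁ :=
  goodBoundaryCovStable_of_kernelCovExpansion stub_kernelCovExpansion stub_flatCovExpansion stub_dirKernelTwoPoint

/-- (v5) L1b is DERIVED: `Theorems.WeakCouplingRates.goodBoundaryMeanSmooth_of_kernelMeanExpansion` (kernel-checked reduction, p467846/p468280). -/
theorem stub_goodBoundaryMeanSmooth :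
    ∃ θ₁ : ℝ, 0 < θ₁ ∧ ∀ θ : ℝ, 0 < θ → θ ≤ θ₁ → GoodBoundaryMeanSmooth (θ / 20) θ (θ / 5) :=
  goodBoundaryMeanSmooth_of_kernelMeanExpansion stub_kernelMeanExpansion stub_dirKernelDiagFlat

theorem stub_boxPolyFloor : ∃ θ₁ : ℝ, 0 < θ₁ ∧ ∀ θ : ℝ, 0 < θ → θ ≤ θ₁ → BoxPolyFloor (θ / 20) θ (2 + θ / 2) := by
  sorry

/-- (v4) CLOSED in the tree: `Theorems.WeakCouplingRates.stub_dlrAssembly`. -/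
theorem stub_dlrAssembly : DlrAssembly :=
  Summit.QuantumFields.YangMills.Theorems.WeakCouplingRates.stub_dlrAssembly

/-- **The composition** (v6: the CLOSED stubs L2 `stub_largeFieldRarity`, L3 `stub_dlrAssembly`, N1′ `stub_dirKernelDiagFlat` and N1
`stub_dirKernelTwoPoint` are discharged inside by their tree theorems, L1a and L1b are derived inside from the census-v3 sub-stubs by the tree
reductions, and (v7) N2-flat `stub_flatCovExpansion` is closed by the sibling crux's DomAbs; the hypotheses are exactly the THREE OPEN stubs): given θ₀ > 0 take θ := min θ₀ (min θ₁ᵃ (min θ₁ᵇ θ₁ᵏ)) > 0 and apply L3 at `(A, δ, θ, K) = (θ/20, θ/5, θ, 2 + θ/2)`; the window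
`K + 4δ + 2A = 2 + 1.4θ < 2 + 2θ`.  Concludes the route's rev-2 crux `BulkDominatesColdBoxW` BY NAME. -/
theorem BulkDominatesColdBoxW_of (hM : Stmt.stub_kernelMeanExpansion)
    (hC : Stmt.stub_kernelCovExpansion) (hK : Stmt.stub_boxPolyFloor) :
    Summit.QuantumFields.YangMills.Theses.WeakCouplingRates.BulkDominatesColdBoxW := by
  have h2 : Stmt.stub_largeFieldRarity := stub_largeFieldRarity
  have h3 : Stmt.stub_dlrAssembly := stub_dlrAssembly
  have hDf : Stmt.stub_dirKernelDiagFlat := stub_dirKernelDiagFlat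
  have hTp : Stmt.stub_dirKernelTwoPoint := stub_dirKernelTwoPoint
  have hFl : Stmt.stub_flatCovExpansion := stub_flatCovExpansion
  have h1a : Stmt.stub_goodBoundaryCovStable := goodBoundaryCovStable_of_kernelCovExpansion hC hFl hTp
  have h1b : Stmt.stub_goodBoundaryMeanSmooth := goodBoundaryMeanSmooth_of_kernelMeanExpansion hM hDf
  obtain ⟨θa, hθa, ha⟩ := h1a
  obtain ⟨θb, hθb, hb⟩ := h1b
  obtain ⟨θk, hθk, hk⟩ := hK
  intro θ₀ hθ₀
  have hθpos : 0 < min θ₀ (min θa (min θb θk)) := lt_min hθ₀ (lt_min hθa (lt_min hθb hθk))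
  have hθ0 : min θ₀ (min θa (min θb θk)) ≤ θ₀ := min_le_left _ _
  have hθa' : min θ₀ (min θa (min θb θk)) ≤ θa := le_trans (min_le_right _ _) (min_le_left _ _)
  have hθb' : min θ₀ (min θa (min θb θk)) ≤ θb :=
    le_trans (min_le_right _ _) (le_trans (min_le_right _ _) (min_le_left _ _))
  have hθk' : min θ₀ (min θa (min θb θk)) ≤ θk :=
    le_trans (min_le_right _ _) (le_trans (min_le_right _ _) (min_le_right _ _))
  obtain ⟨η₁, hη, h1a'⟩ := ha _ hθpos hθa'
  refine ⟨min θ₀ (min θa (min θb θk)) / 20, min θ₀ (min θa (min θb θk)), by positivity, by linarith, hθ0, ?_⟩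
  exact h3 _ _ _ η₁ _ (by positivity) (by positivity) hη (by linarith) h1a' (hb _ hθpos hθb') (h2 _ (by positivity)) (hk _ hθpos hθk')

/-- Signature match: the composition applied to the OPEN stubs has literally the route's rev-2 crux as its type. -/
example : Summit.QuantumFields.YangMills.Theses.WeakCouplingRates.BulkDominatesColdBoxW :=
  BulkDominatesColdBoxW_of stub_kernelMeanExpansion stub_kernelCovExpansion stub_boxPolyFloor

end Summit.QuantumFields.YangMills.Cruxes.BulkDominatesColdBoxW.DlrChessboard
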